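import Literature.AlgebraicGeometry.Motives.MixedHodgeStructureLoewyLengthSubadditive
import HarnessLib

/-!
# `soc^{a+b} H = π⁻¹ soc^b (H / soc^a H)`; Loewy lengths of `H / soc^a H` and `rad^a H`; strictness of both series

For an object of finite length of an abelian category — here a mixed Hodge structure on a finite-dimensional
`ℚ`-space (Cattani–El Zein–Griffiths–Lê, *Hodge Theory*, Thm. 3.2.18; semisimple objects p. 270) — the socle series
`0 = soc⁰ ⊆ soc¹ ⊆ ⋯` (the lower Loewy series, Anderson–Fuller §32: `Soc^k M / Soc^{k-1} M = Soc(M / Soc^{k-1} M)`) and the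
radical series `H = rad⁰ ⊇ rad¹ ⊇ ⋯` (the upper Loewy series) have the following standard additivity and strictness
properties, proved here inside the MHS library (the radical half `rad^{a+b} H = rad^b(rad^a H)` is the tree's
`radicalSeries_add`):

* §1 the first isomorphism theorem for a surjective morphism (`quotientLift_bijective`) and the transport of socles
  along isomorphisms in preimage form (`comap_socle_eq_of_bijective`);
* §2 **`socleSeries_add`**: `soc^{a+b} H = π_a⁻¹ (soc^b (H / soc^a H))` with `π_a : H ↠ H / soc^a H`, equivalently
  `soc^b (H / soc^a H) = π_a (soc^{a+b} H)` (`socleSeries_quotient`);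
* §3 **Loewy lengths of the canonical subquotients**: `ℓ(H / soc^a H) = ℓ(H) - a` (`loewyLength_socleSeries_quotient`),
  `ℓ(rad^a H) = ℓ(H) - a` (`loewyLength_radicalSeries`), in particular `ℓ(H / soc H) = ℓ(rad H) = ℓ(H) - 1`;
* §4 **"none of the Loewy factors is zero"** (Anderson–Fuller §32): `soc^a H < soc^{a+1} H` and `rad^{a+1} H < rad^a H`
  for `a < ℓ(H)`, so both series are strictly monotone up to the Loewy length and constant afterwards
  (`socleSeries_lt_of_lt`, `radicalSeries_lt_of_lt`, `socleSeries_eq_top_iff_le`, `radicalSeries_eq_bot_iff_le`).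

Namespace `MixedHodgeStructure`; everything proved, no named facts.

## References

* [CattaniElZeinGriffithsLe2014] E. Cattani et al. (eds.), Hodge Theory (2014), Thm. 3.2.18, Lemma 3.2.20, p. 270.
* [AndersonFuller1992] F. W. Anderson, K. R. Fuller, Rings and Categories of Modules, 2nd ed. (1992), §32 (p. 346):
  Loewy length, upper and lower Loewy series, `Soc^k M / Soc^{k-1} M = Soc(M / Soc^{k-1} M)`, "none are zero".
-/

noncomputable section

namespace Literature.AlgebraicGeometry.Motives

namespace MixedHodgeStructure

universe u v

variable {V : Type u} [AddCommGroup V] [Module ℚ V]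
variable {V' : Type v} [AddCommGroup V'] [Module ℚ V']
variable {H : MixedHodgeStructure V} {H' : MixedHodgeStructure V'}

open Module SubMixedHodgeStructure

/-! ### §1 First isomorphism theorem; socles under isomorphisms -/

/-- **First isomorphism theorem for a surjective morphism**: if `g : H ↠ H'` has kernel `S`, the induced morphism
`H / S → H'` is an isomorphism of MHS. [cite: CattaniElZeinGriffithsLe2014, Thm. 3.2.18] -/
theorem SubMixedHodgeStructure.quotientLift_bijective (S : SubMixedHodgeStructure H) (g : Hom H H')
    (hg : S.toSubmodule ≤ LinearMap.ker g.toLinearMap) (hker : LinearMap.ker g.toLinearMap ≤ S.toSubmodule)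
    (hsurj : Function.Surjective g.toLinearMap) : Function.Bijective (S.quotientLift g hg).toLinearMap := by
  constructor
  · rw [← LinearMap.ker_eq_bot]
    exact Submodule.ker_liftQ_eq_bot _ _ _ hker
  · rw [← LinearMap.range_eq_top]
    change LinearMap.range (S.toSubmodule.liftQ g.toLinearMap hg) = ⊤
    rw [Submodule.range_liftQ, LinearMap.range_eq_top.2 hsurj]

/-- An isomorphism pulls the socle back to the socle. [cite: CattaniElZeinGriffithsLe2014, Thm. 3.2.18] -/
theorem comap_socle_eq_of_bijective [FiniteDimensional ℚ V] [FiniteDimensional ℚ V'] (f : Hom H H')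
    (hf : Function.Bijective f.toLinearMap) :
    (socle H').toSubmodule.comap f.toLinearMap = (socle H).toSubmodule := by
  rw [← map_socle_eq_of_bijective f hf, Submodule.comap_map_eq_of_injective hf.1]

/-! ### §2 `soc^{a+b} H = π_a⁻¹ (soc^b (H / soc^a H))` -/

section SocleSeries

variable [FiniteDimensional ℚ V]

variable (H) in
/-- **`soc^{a+b} H = π_a⁻¹ (soc^b (H / soc^a H))`** (`π_a : H ↠ H / soc^a H`): by induction on `b`, using the isomorphism
`H / soc^{a+b} H ≅ (H / soc^a H) / soc^b (H / soc^a H)` (first isomorphism theorem) and the transport of socles.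
[cite: AndersonFuller1992, §32 (p. 346)] [cite: CattaniElZeinGriffithsLe2014, Thm. 3.2.18 and p. 270] -/
theorem socleSeries_add (a b : ℕ) :
    (socleSeries H (a + b)).toSubmodule =
      (socleSeries (socleSeries H a).quotient b).toSubmodule.comap (socleSeries H a).toSubmodule.mkQ := by
  induction b with
  | zero =>
    rw [Nat.add_zero, socleSeries_zero, SubMixedHodgeStructure.bot_toSubmodule, Submodule.comap_bot, Submodule.ker_mkQ]
  | succ b ih =>
    -- `ρ : H ↠ (H / soc^a) / soc^b (H / soc^a)` has kernel `soc^{a+b} H` (induction hypothesis)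
    let ρ : Hom H (socleSeries (socleSeries H a).quotient b).quotient :=
      (socleSeries (socleSeries H a).quotient b).mkQ.comp (socleSeries H a).mkQ
    have hker : LinearMap.ker ρ.toLinearMap = (socleSeries H (a + b)).toSubmodule := by
      rw [Hom.comp_toLinearMap, LinearMap.ker_comp]
      change (LinearMap.ker (socleSeries (socleSeries H a).quotient b).toSubmodule.mkQ).comap
        (socleSeries H a).toSubmodule.mkQ = _
      rw [Submodule.ker_mkQ, ih]
    have hsurj : Function.Surjective ρ.toLinearMap :=
      (Submodule.mkQ_surjective _).comp (Submodule.mkQ_surjective _)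
    -- the induced isomorphism `θ : H / soc^{a+b} H ⥲ (H / soc^a) / soc^b (H / soc^a)`
    let θ : Hom (socleSeries H (a + b)).quotient (socleSeries (socleSeries H a).quotient b).quotient :=
      (socleSeries H (a + b)).quotientLift ρ hker.ge
    have hθ : Function.Bijective θ.toLinearMap :=
      (socleSeries H (a + b)).quotientLift_bijective ρ hker.ge hker.le hsurj
    have hcomp : θ.toLinearMap ∘ₗ (socleSeries H (a + b)).mkQ.toLinearMap =
        (socleSeries (socleSeries H a).quotient b).mkQ.toLinearMap ∘ₗ (socleSeries H a).toSubmodule.mkQ :=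
      LinearMap.ext fun _ => rfl
    rw [show a + (b + 1) = (a + b) + 1 from rfl, socleSeries_succ_toSubmodule, socleSeries_succ_toSubmodule,
      ← comap_socle_eq_of_bijective θ hθ, ← Submodule.comap_comp, hcomp, Submodule.comap_comp]

variable (H) in
/-- Equivalently **`soc^b (H / soc^a H) = π_a (soc^{a+b} H)`**. [cite: AndersonFuller1992, §32 (p. 346)]
[cite: CattaniElZeinGriffithsLe2014, p. 270] -/
theorem socleSeries_quotient (a b : ℕ) :
    (socleSeries (socleSeries H a).quotient b).toSubmodule =
      (socleSeries H (a + b)).toSubmodule.map (socleSeries H a).toSubmodule.mkQ := by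
  rw [socleSeries_add, Submodule.map_comap_eq_of_surjective (Submodule.mkQ_surjective _)]

variable (H) in
/-- `soc^a H ⊆ soc^{a+b} H` contains the kernel of `π_a`, so nothing is lost: `soc^b (H/soc^a H) = ⊤ ↔ soc^{a+b} H = H`.
[cite: AndersonFuller1992, §32 (p. 346)] [cite: CattaniElZeinGriffithsLe2014, p. 270] -/
theorem socleSeries_quotient_eq_top_iff (a b : ℕ) :
    (socleSeries (socleSeries H a).quotient b).toSubmodule = ⊤ ↔ (socleSeries H (a + b)).toSubmodule = ⊤ := by
  rw [socleSeries_add]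
  constructor
  · intro h
    rw [h, Submodule.comap_top]
  · intro h
    rw [← Submodule.map_comap_eq_of_surjective (Submodule.mkQ_surjective (socleSeries H a).toSubmodule)
      (socleSeries (socleSeries H a).quotient b).toSubmodule, h, Submodule.map_top, Submodule.range_mkQ]

variable (H) in
/-- Dually `rad^b (rad^a H) = 0 ↔ rad^{a+b} H = 0` (from the tree's `radicalSeries_add`).
[cite: AndersonFuller1992, §32 (p. 346)] [cite: CattaniElZeinGriffithsLe2014, p. 270] -/
theorem radicalSeries_radicalSeries_eq_bot_iff (a b : ℕ) :
    (radicalSeries (radicalSeries H a).toMixedHodgeStructure b).toSubmodule = ⊥ ↔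
      (radicalSeries H (a + b)).toSubmodule = ⊥ := by
  rw [radicalSeries_add]
  constructor
  · intro h
    rw [h, Submodule.map_bot]
  · intro h
    apply Submodule.map_injective_of_injective (Submodule.injective_subtype (radicalSeries H a).toSubmodule)
    rw [h, Submodule.map_bot]

/-! ### §3 Loewy lengths of `H / soc^a H` and `rad^a H` -/

variable (H) in
/-- **`ℓ(H / soc^a H) = ℓ(H) - a`.** [cite: AndersonFuller1992, §32 (p. 346)] [cite: CattaniElZeinGriffithsLe2014, p. 270] -/
theorem loewyLength_socleSeries_quotient (a : ℕ) :
    loewyLength (socleSeries H a).quotient = loewyLength H - a := by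
  apply le_antisymm
  · rw [loewyLength_le_iff, socleSeries_quotient_eq_top_iff]
    exact socleSeries_eq_top_of_le H le_add_tsub (socleSeries_loewyLength_eq_top H)
  · rw [Nat.sub_le_iff_le_add, loewyLength_le_iff, add_comm, ← socleSeries_quotient_eq_top_iff]
    exact socleSeries_loewyLength_eq_top _

variable (H) in
/-- **`ℓ(rad^a H) = ℓ(H) - a`.** [cite: AndersonFuller1992, §32 (p. 346)] [cite: CattaniElZeinGriffithsLe2014, p. 270] -/
theorem loewyLength_radicalSeries (a : ℕ) :
    loewyLength (radicalSeries H a).toMixedHodgeStructure = loewyLength H - a := by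
  apply le_antisymm
  · rw [loewyLength_le_iff_radicalSeries_eq_bot, radicalSeries_radicalSeries_eq_bot_iff]
    exact radicalSeries_eq_bot_of_le H le_add_tsub radicalSeries_loewyLength_eq_bot
  · rw [Nat.sub_le_iff_le_add, loewyLength_le_iff_radicalSeries_eq_bot, add_comm,
      ← radicalSeries_radicalSeries_eq_bot_iff]
    exact radicalSeries_loewyLength_eq_bot

variable (H) in
/-- **`ℓ(H / soc H) = ℓ(H) - 1`.** [cite: AndersonFuller1992, §32 (p. 346)] [cite: CattaniElZeinGriffithsLe2014, p. 270] -/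
theorem loewyLength_socle_quotient : loewyLength (socle H).quotient = loewyLength H - 1 := by
  rw [← socleSeries_one]
  exact loewyLength_socleSeries_quotient H 1

variable (H) in
/-- **`ℓ(rad H) = ℓ(H) - 1`.** [cite: AndersonFuller1992, §32 (p. 346)] [cite: CattaniElZeinGriffithsLe2014, p. 270] -/
theorem loewyLength_radical : loewyLength (radical H).toMixedHodgeStructure = loewyLength H - 1 := by
  rw [← radicalSeries_one]
  exact loewyLength_radicalSeries H 1

variable (H) in
/-- `ℓ(H / soc^a H) = ℓ(rad^a H)`: the two canonical subquotients at depth `a` have the same Loewy length.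
[cite: AndersonFuller1992, §32 (p. 346)] -/
theorem loewyLength_socleSeries_quotient_eq_loewyLength_radicalSeries (a : ℕ) :
    loewyLength (socleSeries H a).quotient = loewyLength (radicalSeries H a).toMixedHodgeStructure := by
  rw [loewyLength_socleSeries_quotient, loewyLength_radicalSeries]

/-! ### §4 Strictness: none of the Loewy factors below the Loewy length is zero -/

/-- **`soc^a H < soc^{a+1} H` for `a < ℓ(H)`**: `H / soc^a H ≠ 0` has a non-zero socle.
[cite: AndersonFuller1992, §32 (p. 346)] [cite: CattaniElZeinGriffithsLe2014, p. 270] -/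
theorem socleSeries_lt_succ {a : ℕ} (ha : a < loewyLength H) :
    (socleSeries H a).toSubmodule < (socleSeries H (a + 1)).toSubmodule := by
  refine lt_of_le_of_ne (le_socleSeries_succ H a) fun h => ?_
  have hQ : (socle (socleSeries H a).quotient).toSubmodule = ⊥ := by
    rw [← map_socleSeries_succ H a, ← h]
    exact Submodule.mkQ_map_self _
  haveI : Nontrivial (V ⧸ (socleSeries H a).toSubmodule) :=
    Submodule.Quotient.nontrivial_iff.2 (socleSeries_ne_top_of_lt ha)
  exact socle_ne_bot hQ

/-- **`rad^{a+1} H < rad^a H` for `a < ℓ(H)`**: `rad^a H ≠ 0` has a proper radical.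
[cite: AndersonFuller1992, §32 (p. 346)] [cite: CattaniElZeinGriffithsLe2014, p. 270] -/
theorem radicalSeries_succ_lt {a : ℕ} (ha : a < loewyLength H) :
    (radicalSeries H (a + 1)).toSubmodule < (radicalSeries H a).toSubmodule := by
  refine lt_of_le_of_ne (radicalSeries_succ_le H a) fun h => ?_
  have hR : (radical (radicalSeries H a).toMixedHodgeStructure).toSubmodule = ⊤ := by
    apply Submodule.map_injective_of_injective (Submodule.injective_subtype (radicalSeries H a).toSubmodule)
    rw [Submodule.map_top, Submodule.range_subtype]
    exact (radicalSeries_succ_toSubmodule H a).symm.trans h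
  haveI : Nontrivial ↥(radicalSeries H a).toSubmodule := Submodule.nontrivial_iff_ne_bot.2 (radicalSeries_ne_bot_of_lt ha)
  exact radical_ne_top hR

/-- The socle series is strictly increasing on `[0, ℓ(H)]`. [cite: AndersonFuller1992, §32 (p. 346)] -/
theorem socleSeries_lt_of_lt {a b : ℕ} (hab : a < b) (hb : b ≤ loewyLength H) :
    (socleSeries H a).toSubmodule < (socleSeries H b).toSubmodule :=
  (socleSeries_lt_succ (lt_of_lt_of_le hab hb)).trans_le (socleSeries_mono H (Nat.succ_le_of_lt hab))

/-- The radical series is strictly decreasing on `[0, ℓ(H)]`. [cite: AndersonFuller1992, §32 (p. 346)] -/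
theorem radicalSeries_lt_of_lt {a b : ℕ} (hab : a < b) (hb : b ≤ loewyLength H) :
    (radicalSeries H b).toSubmodule < (radicalSeries H a).toSubmodule :=
  (radicalSeries_antitone H (Nat.succ_le_of_lt hab)).trans_lt (radicalSeries_succ_lt (lt_of_lt_of_le hab hb))

variable (H) in
/-- **`soc^a H = H ↔ ℓ(H) ≤ a`** (the socle series reaches `H` exactly at the Loewy length and stays there).
[cite: AndersonFuller1992, §32 (p. 346)] [cite: CattaniElZeinGriffithsLe2014, p. 270] -/
theorem socleSeries_eq_top_iff_le (a : ℕ) : (socleSeries H a).toSubmodule = ⊤ ↔ loewyLength H ≤ a :=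
  (loewyLength_le_iff H).symm

variable (H) in
/-- **`rad^a H = 0 ↔ ℓ(H) ≤ a`.** [cite: AndersonFuller1992, §32 (p. 346)] [cite: CattaniElZeinGriffithsLe2014, p. 270] -/
theorem radicalSeries_eq_bot_iff_le (a : ℕ) : (radicalSeries H a).toSubmodule = ⊥ ↔ loewyLength H ≤ a :=
  loewyLength_le_iff_radicalSeries_eq_bot.symm

variable (H) in
/-- The socle series is injective on `[0, ℓ(H)]`: `soc^a H = soc^b H` with `a, b ≤ ℓ(H)` forces `a = b`.
[cite: AndersonFuller1992, §32 (p. 346)] -/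
theorem socleSeries_injOn {a b : ℕ} (ha : a ≤ loewyLength H) (hb : b ≤ loewyLength H)
    (h : (socleSeries H a).toSubmodule = (socleSeries H b).toSubmodule) : a = b := by
  by_contra hne
  rcases lt_or_gt_of_ne hne with hlt | hlt
  · exact (socleSeries_lt_of_lt hlt hb).ne h
  · exact (socleSeries_lt_of_lt hlt ha).ne h.symm

variable (H) in
/-- The radical series is injective on `[0, ℓ(H)]`. [cite: AndersonFuller1992, §32 (p. 346)] -/
theorem radicalSeries_injOn {a b : ℕ} (ha : a ≤ loewyLength H) (hb : b ≤ loewyLength H)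
    (h : (radicalSeries H a).toSubmodule = (radicalSeries H b).toSubmodule) : a = b := by
  by_contra hne
  rcases lt_or_gt_of_ne hne with hlt | hlt
  · exact (radicalSeries_lt_of_lt hlt hb).ne h.symm
  · exact (radicalSeries_lt_of_lt hlt ha).ne h

/-- **`a ≤ dim soc^a H`** for `a ≤ ℓ(H)`: each of the first `ℓ(H)` Loewy factors is non-zero.
[cite: AndersonFuller1992, §32 (p. 346)] [cite: CattaniElZeinGriffithsLe2014, p. 270] -/
theorem le_finrank_socleSeries {a : ℕ} (ha : a ≤ loewyLength H) : a ≤ finrank ℚ (socleSeries H a).toSubmodule := by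
  induction a with
  | zero => exact Nat.zero_le _
  | succ a ih =>
    have hlt := Submodule.finrank_lt_finrank_of_lt (socleSeries_lt_succ (Nat.lt_of_succ_le ha))
    have := ih (Nat.le_of_succ_le ha)
    omega

/-- **`dim rad^a H + a ≤ dim H`** for `a ≤ ℓ(H)`. [cite: AndersonFuller1992, §32 (p. 346)] [cite: CattaniElZeinGriffithsLe2014, p. 270] -/
theorem finrank_radicalSeries_add_le {a : ℕ} (ha : a ≤ loewyLength H) :
    finrank ℚ (radicalSeries H a).toSubmodule + a ≤ finrank ℚ V := by
  induction a with
  | zero => rw [add_zero]; exact Submodule.finrank_le _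
  | succ a ih =>
    have hlt := Submodule.finrank_lt_finrank_of_lt (radicalSeries_succ_lt (Nat.lt_of_succ_le ha))
    have := ih (Nat.le_of_succ_le ha)
    omega

/-- Hence `ℓ(H) ≤ dim H` again, now with the information that `dim soc^{ℓ(H)} H ≥ ℓ(H)` is attained along a
strictly increasing chain. [cite: CattaniElZeinGriffithsLe2014, p. 270] -/
theorem loewyLength_le_finrank_socleSeries : loewyLength H ≤ finrank ℚ (socleSeries H (loewyLength H)).toSubmodule :=
  le_finrank_socleSeries le_rfl

end SocleSeries

end MixedHodgeStructure

end Literature.AlgebraicGeometry.Motives
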